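import Summits.ValiantsHypothesis.ValiantsHypothesis.Theorems.KPlusLogSqLawTropicalBParityLaw
import Summits.ValiantsHypothesis.ValiantsHypothesis.Theorems.LacunarySymmetroidMatrixDescartesCensusTropicalKLawSlopes

/-!
# Route «KPlusLogSqLaw», crux `TropicalB` (stmt-ValiantsHypothesis-19771) — PARITY CENSUS:
# on a board of EVEN size, five separated classes force every dominant chain to miss a histogram (`n + 2 ≤ multichoose K m`)

HONEST FRAMING.  Census corollary of the parity law (`…TropicalBParityLaw`, same seat val-sym-trop-p4 g10, 2026-08-27; cell
`pub-symmetroid`; `--supports stmt-ValiantsHypothesis-19771 --as helper`).  It proves no part of the registered stubs and asserts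
nothing about `TropicalB` in its window, `WeakLifting`, DoorA26 / DoorA34, `MatrixDescartes` (stmt-ValiantsHypothesis-18050) or VP ≠ VNP.

* `classSym_surjective_of_full` — a chain of unique optima with `multichoose K m` terms visits EVERY class multiset (pigeonhole on
  `TropicalCensus.classSym`; the general form of `ForbiddenPatterns.exists_pos_of_ge`).
* `const_of_classSym_replicate`, `oneOff_of_classSym_cons` — reading the class function off the multisets `m·{c}` and `{c'} + (m−1)·{c}`.
* `parity_census` — **`m` even, `m ≥ 2`, classes with `d c₀ < d c₁ < d c₂`, `d c₁ < d c₃`, `d c₀ < d c₄` and pattern slopes ordered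
  `m·d c₂ < (m−1)·d c₁ + d c₃ < (m−1)·d c₀ + d c₄` (all automatic for exponents super-increasing by the size — the lexicographic
  regime): every chain of unique optima at strictly increasing slopes with consecutive terms distinct has `n + 2 ≤ multichoose K m`.**
  So the lexicographic `(m, K)` cells with `m` EVEN and `K ≥ 5` are never counting-tight — an infinite family of deficient cells decided by
  a PARITY mechanism (three Hamiltonian quotients), complementing the `m = 3` patterns of …TropicalBForbiddenPatterns; first instance
  `(4,5)`: at most `69` terms (`n ≤ 68 < 69 = C(8,4) − 1`).  The deficiency is ONE histogram per triple — a calibration datum for the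
  lexicographic sector, not a bound of `TropicalB` shape.  [this cell]
-/

set_option linter.dupNamespace false
set_option autoImplicit false

namespace Summit.ValiantsHypothesis.ValiantsHypothesis.Theorems.KPlusLogSqLaw.ParityLaw

open Summit.ValiantsHypothesis.ValiantsHypothesis.Theorems.MatrixDescartes.Negative
open Summit.ValiantsHypothesis.ValiantsHypothesis.Theorems.LacunarySymmetroidMatrixDescartes.TropicalCensus
open Finset

variable {m K : ℕ}

/-- **a chain with `multichoose K m` terms visits every class multiset** (pigeonhole on `classSym`, the general form of
`ForbiddenPatterns.exists_pos_of_ge`). [folklore] -/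
theorem classSym_surjective_of_full (d : Fin K → ℕ) (v ε : Fin m → Fin m → Fin K → ℤ) {n : ℕ} (θ : Fin (n + 1) → ℤ)
    (p : Fin (n + 1) → Equiv.Perm (Fin m) × (Fin m → Fin K)) (hθ : StrictMono θ)
    (hdom : ∀ k, IsDominant d v ε (θ k) (p k)) (hne : ∀ k : Fin n, p k.castSucc ≠ p k.succ)
    (hn : Nat.multichoose K m ≤ n + 1) :
    (StrictMono fun k => slope d (p k)) ∧ Function.Surjective fun k => classSym (p k) := by
  have hsm : StrictMono fun k => slope d (p k) := by
    rw [Fin.strictMono_iff_lt_succ]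
    intro k
    exact slope_lt_of_dominant d v ε (hθ Fin.castSucc_lt_succ) (hne k) (hdom _) (hdom _)
  have hinj : Function.Injective fun k => classSym (p k) := by
    intro k k' h
    apply hsm.injective
    simp only
    rw [slope_eq_of_classSym, slope_eq_of_classSym]
    exact congrArg (fun M : Sym (Fin K) m => ((M : Multiset (Fin K)).map fun l => (d l : ℤ)).sum) h
  have hbij : Function.Bijective fun k => classSym (p k) := by
    rw [Fintype.bijective_iff_injective_and_card]
    refine ⟨hinj, ?_⟩
    have hle := Fintype.card_le_of_injective _ hinj
    rw [Fintype.card_fin, Sym.card_sym_eq_multichoose, Fintype.card_fin] at hle ⊢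
    omega
  exact ⟨hsm, hbij.2⟩

/-- a term whose class multiset is `m·{c}` has every column of class `c`. [folklore] -/
theorem const_of_classSym_replicate {p : Equiv.Perm (Fin m) × (Fin m → Fin K)} {c : Fin K}
    (h : (classSym p : Multiset (Fin K)) = Multiset.replicate m c) (b : Fin m) : p.2 b = c := by
  have hmem : p.2 b ∈ (classSym p : Multiset (Fin K)) := by
    change p.2 b ∈ (univ : Finset (Fin m)).val.map p.2
    exact Multiset.mem_map_of_mem _ (mem_univ b)
  rw [h] at hmem
  exact Multiset.eq_of_mem_replicate hmem

/-- a term whose class multiset is `{c'} + (m−1)·{c}` with `c ≠ c'` has class `c'` at exactly one column and `c` elsewhere. [folklore] -/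
theorem oneOff_of_classSym_cons {p : Equiv.Perm (Fin m) × (Fin m → Fin K)} {c c' : Fin K} (hcc : c ≠ c')
    (h : (classSym p : Multiset (Fin K)) = c' ::ₘ Multiset.replicate (m - 1) c) :
    ∃ bs : Fin m, p.2 bs = c' ∧ ∀ b, b ≠ bs → p.2 b = c := by
  classical
  have hval : (classSym p : Multiset (Fin K)) = (univ : Finset (Fin m)).val.map p.2 := rfl
  -- a column of class `c'`
  have hc' : c' ∈ (univ : Finset (Fin m)).val.map p.2 := by rw [← hval, h]; exact Multiset.mem_cons_self _ _
  obtain ⟨bs, -, hbs⟩ := Multiset.mem_map.mp hc'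
  refine ⟨bs, hbs, fun b hb => ?_⟩
  -- every class is `c` or `c'`
  have hmem : p.2 b ∈ (univ : Finset (Fin m)).val.map p.2 := Multiset.mem_map_of_mem _ (mem_univ b)
  rw [← hval, h, Multiset.mem_cons] at hmem
  rcases hmem with hb' | hb'
  · -- two columns of class `c'` contradict the count
    exfalso
    have hcount : Multiset.count c' ((univ : Finset (Fin m)).val.map p.2) = 1 := by
      rw [← hval, h, Multiset.count_cons_self, Multiset.count_replicate, if_neg hcc]
    have hsub : (({bs, b} : Finset (Fin m)).val.map p.2) ≤ (univ : Finset (Fin m)).val.map p.2 :=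
      Multiset.map_le_map (Finset.val_le_iff.mpr (Finset.subset_univ _))
    have hpair : ({bs, b} : Finset (Fin m)).val = bs ::ₘ {b} := by
      rw [Finset.insert_val, Multiset.ndinsert_of_notMem (by simpa using hb.symm)]; rfl
    have htwo : Multiset.count c' ((({bs, b} : Finset (Fin m)).val.map p.2)) = 2 := by
      rw [hpair, Multiset.map_cons, Multiset.map_singleton, hbs, hb', Multiset.count_cons_self, Multiset.count_singleton_self]
    have := Multiset.count_le_of_le c' hsub
    omega
  · exact Multiset.eq_of_mem_replicate hb'

/-- **PARITY CENSUS.**  `m` even, `m ≥ 2`; five classes with `d c₀ < d c₁ < d c₂`, `d c₁ < d c₃`, `d c₀ < d c₄` and the three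
pattern slopes in increasing order (`m·d c₂ < (m−1)·d c₁ + d c₃ < (m−1)·d c₀ + d c₄` — automatic for exponents super-increasing by
the size).  Then every chain of unique optima at strictly increasing slopes (consecutive terms distinct) has `n + 2 ≤ multichoose K m`:
it misses at least one of the histograms `m·{c₂}`, `(m−1)·{c₁} + {c₃}`, `(m−1)·{c₀} + {c₄}`.  The lexicographic cells of EVEN size
with `K ≥ 5` classes are never counting-tight. [this cell] -/
theorem parity_census (heven : Even m) (hm : 2 ≤ m) (d : Fin K → ℕ) (v ε : Fin m → Fin m → Fin K → ℤ)
    (c₀ c₁ c₂ c₃ c₄ : Fin K) (h01 : d c₀ < d c₁) (h12 : d c₁ < d c₂) (h13 : d c₁ < d c₃) (h04 : d c₀ < d c₄)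
    (hAB : (m : ℤ) * d c₂ < (m - 1 : ℤ) * d c₁ + d c₃) (hBC : (m - 1 : ℤ) * d c₁ + d c₃ < (m - 1 : ℤ) * d c₀ + d c₄)
    {n : ℕ} (θ : Fin (n + 1) → ℤ) (p : Fin (n + 1) → Equiv.Perm (Fin m) × (Fin m → Fin K))
    (hθ : StrictMono θ) (hdom : ∀ k, IsDominant d v ε (θ k) (p k)) (hne : ∀ k : Fin n, p k.castSucc ≠ p k.succ) :
    n + 2 ≤ Nat.multichoose K m := by
  classical
  by_contra hlt
  have hn : Nat.multichoose K m ≤ n + 1 := by omega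
  obtain ⟨hsm, hsurj⟩ := classSym_surjective_of_full d v ε θ p hθ hdom hne hn
  obtain ⟨m', hm'⟩ : ∃ m', m = m' + 1 := ⟨m - 1, by omega⟩
  -- the three pattern multisets as elements of `Sym (Fin K) m`
  have cardA : Multiset.card (Multiset.replicate m c₂) = m := Multiset.card_replicate _ _
  have cardB : Multiset.card (c₃ ::ₘ Multiset.replicate (m - 1) c₁) = m := by
    rw [Multiset.card_cons, Multiset.card_replicate]; omega
  have cardC : Multiset.card (c₄ ::ₘ Multiset.replicate (m - 1) c₀) = m := by
    rw [Multiset.card_cons, Multiset.card_replicate]; omega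
  obtain ⟨kA, hkA⟩ := hsurj ⟨Multiset.replicate m c₂, cardA⟩
  obtain ⟨kB, hkB⟩ := hsurj ⟨c₃ ::ₘ Multiset.replicate (m - 1) c₁, cardB⟩
  obtain ⟨kC, hkC⟩ := hsurj ⟨c₄ ::ₘ Multiset.replicate (m - 1) c₀, cardC⟩
  have hkA' : (classSym (p kA) : Multiset (Fin K)) = Multiset.replicate m c₂ := congrArg Subtype.val hkA
  have hkB' : (classSym (p kB) : Multiset (Fin K)) = c₃ ::ₘ Multiset.replicate (m - 1) c₁ := congrArg Subtype.val hkB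
  have hkC' : (classSym (p kC) : Multiset (Fin K)) = c₄ ::ₘ Multiset.replicate (m - 1) c₀ := congrArg Subtype.val hkC
  -- shapes
  have hlA : ∀ b, (p kA).2 b = c₂ := const_of_classSym_replicate hkA'
  obtain ⟨bs, hbs, hlB⟩ := oneOff_of_classSym_cons (fun h => (ne_of_lt h13) (by rw [h])) hkB'
  obtain ⟨cs, hcs, hlC⟩ := oneOff_of_classSym_cons (fun h => (ne_of_lt h04) (by rw [h])) hkC'
  -- slopes of the three terms
  have slA : slope d (p kA) = (m : ℤ) * d c₂ := by
    rw [slope_eq_of_classSym, hkA', Multiset.map_replicate, Multiset.sum_replicate, nsmul_eq_mul]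
  have slB : slope d (p kB) = (d c₃ : ℤ) + (m - 1 : ℤ) * d c₁ := by
    rw [slope_eq_of_classSym, hkB', Multiset.map_cons, Multiset.sum_cons, Multiset.map_replicate, Multiset.sum_replicate,
      nsmul_eq_mul]
    push_cast [Nat.cast_sub (by omega : 1 ≤ m)]
    ring
  have slC : slope d (p kC) = (d c₄ : ℤ) + (m - 1 : ℤ) * d c₀ := by
    rw [slope_eq_of_classSym, hkC', Multiset.map_cons, Multiset.sum_cons, Multiset.map_replicate, Multiset.sum_replicate,
      nsmul_eq_mul]
    push_cast [Nat.cast_sub (by omega : 1 ≤ m)]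
    ring
  -- index order from slope order
  have hAB' : kA < kB := by
    have hs : slope d (p kA) < slope d (p kB) := by rw [slA, slB]; linarith
    exact hsm.lt_iff_lt.mp hs
  have hBC' : kB < kC := by
    have hs : slope d (p kB) < slope d (p kC) := by rw [slB, slC]; linarith
    exact hsm.lt_iff_lt.mp hs
  -- the parity law
  refine parity_law_chain heven hm d v ε c₀ c₁ c₂ h01 h12 θ p hθ hdom hAB' hBC' bs cs hlA hlB ?_ hlC
  rw [hbs]; exact h01.trans h13

end Summit.ValiantsHypothesis.ValiantsHypothesis.Theorems.KPlusLogSqLaw.ParityLaw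

/-! ## Appended: the lexicographic form (exponents super-increasing by the size) -/

namespace Summit.ValiantsHypothesis.ValiantsHypothesis.Theorems.KPlusLogSqLaw.ParityLaw

open Summit.ValiantsHypothesis.ValiantsHypothesis.Theorems.MatrixDescartes.Negative
open Summit.ValiantsHypothesis.ValiantsHypothesis.Theorems.LacunarySymmetroidMatrixDescartes.TropicalCensus

variable {m K : ℕ}

/-- **PARITY CENSUS IN THE LEX SECTOR.**  `m` even, `m ≥ 2`, exponents super-increasing by the size (`d l < d l' → m·d l < d l'`, the
hypothesis of …ScaleSeparation / …OdometerLocality / …CarryCycle), and five classes with strictly increasing exponents.  Then every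
chain of unique optima at strictly increasing slopes with consecutive terms distinct has `n + 2 ≤ multichoose K m`: **a lexicographic
cell of EVEN size with at least five distinct exponent values is never counting-tight.** (The slope order of the three parity patterns
follows from super-increase: `d c₃ > m·d c₂` and `d c₄ > m·d c₃ ≥ d c₃ + (m−1)·d c₁`.) [this cell] -/
theorem parity_census_lex (heven : Even m) (hm : 2 ≤ m) (d : Fin K → ℕ)
    (hsup : ∀ l l' : Fin K, d l < d l' → m * d l < d l') (v ε : Fin m → Fin m → Fin K → ℤ)
    (c₀ c₁ c₂ c₃ c₄ : Fin K) (h01 : d c₀ < d c₁) (h12 : d c₁ < d c₂) (h23 : d c₂ < d c₃) (h34 : d c₃ < d c₄)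
    {n : ℕ} (θ : Fin (n + 1) → ℤ) (p : Fin (n + 1) → Equiv.Perm (Fin m) × (Fin m → Fin K))
    (hθ : StrictMono θ) (hdom : ∀ k, IsDominant d v ε (θ k) (p k)) (hne : ∀ k : Fin n, p k.castSucc ≠ p k.succ) :
    n + 2 ≤ Nat.multichoose K m := by
  have h3 := hsup c₂ c₃ h23   -- m·d c₂ < d c₃
  have h4 := hsup c₃ c₄ h34   -- m·d c₃ < d c₄
  have h3z : (m : ℤ) * d c₂ < d c₃ := by exact_mod_cast h3
  have h4z : (m : ℤ) * d c₃ < d c₄ := by exact_mod_cast h4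
  have h01z : (d c₀ : ℤ) < d c₁ := by exact_mod_cast h01
  have h13z : (d c₁ : ℤ) < d c₃ := by exact_mod_cast h12.trans h23
  have hm1 : (1 : ℤ) ≤ (m : ℤ) - 1 := by
    have : (2 : ℤ) ≤ m := by exact_mod_cast hm
    linarith
  refine parity_census heven hm d v ε c₀ c₁ c₂ c₃ c₄ h01 h12 (h12.trans h23) (h01.trans (h12.trans (h23.trans h34))) ?_ ?_
    θ p hθ hdom hne
  · -- m·d c₂ < (m−1)·d c₁ + d c₃
    nlinarith
  · -- (m−1)·d c₁ + d c₃ < (m−1)·d c₀ + d c₄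
    have : ((m : ℤ) - 1) * d c₁ ≤ ((m : ℤ) - 1) * d c₃ := by nlinarith
    nlinarith

end Summit.ValiantsHypothesis.ValiantsHypothesis.Theorems.KPlusLogSqLaw.ParityLaw
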